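import Literature.NumberTheory.GaloisRepresentations.ContinuousH1
import Mathlib.NumberTheory.Padics.PadicIntegers
import Mathlib.Topology.MetricSpace.Ultra.Basic
import Mathlib.Topology.Algebra.Group.Quotient
import Mathlib.Topology.Compactness.Compact
import HarnessLib

/-!
# Unramified classes die on the kernel of a `ℤ_p`-valued character that kills inertia and not
# Frobenius: `res_{ker χ} [φ] = 0` for a finite discrete `p`-power-torsion representation
# (cell `b2b-bsdres`, team n1011, seat p10 GEN 4; OWNERS row T-E3g-BUD0, FILE 3 — the local lemma,
# abstract form, for any object of Mathlib's `TopRep ℤ G`)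

HONEST FRAMING (cell `b2b-bsdres`, run/shared/lean/b2b/bsd-rank1-residual/, verbatim in every
file): the goal of the cell is to DELETE the COMBINATION-SHAPED residual classes of the
Birch–Swinnerton-Dyer formula for ALL analytic-rank `≤ 1` elliptic curves over `ℚ` — "full BSD
formula for every rank `≤ 1` curve in class `C`" assembled STRICTLY from published theorems — so
that the rank-`≤ 1` remainder becomes exactly the CONSTRUCTION-SHAPED classes, which are TYPED
(missing-input `Prop`s), NOT attempted. This is not "finishing BSD". THEOREMS ONLY (no definition,
no named fact, nothing asserted): elementary continuous-cocycle algebra on a compact group.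

## What and why (row T-E3g-BUD0, FILES 1–2 = `Additive/BudgetFromRationalClasses.lean`,
## `Additive/RationalClassesToLayerZero.lean`)

FILE 2 reduced "a class `y ∈ H¹(K, E[p])` unramified at a Tamagawa prime `v ∤ p` contributes to
`A_0 = h_0⁻¹(Sel_{p^∞}(E/K_∞))`" to the LOCAL statement: the class of `y` restricted to the
subgroup `G' = Gal(K̄_v/K_{∞,η}) ≤ Γ_{K_v}` vanishes. Here `G' = ker χ` for the local character
`χ = κ ∘ (Γ_{K_v} → Γ_K) : Γ_{K_v} → ℤ_p`, which kills the inertia group `I_v` (a `ℤ_p`-extension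
is unramified outside `p`; locally the tree's `apply_eq_one_of_mem_absInertia`) and does NOT kill
a Frobenius `F` when `v` is not totally split in `K_∞` (always, for the cyclotomic tower:
`X2.GreenbergVatsalUnramifiedAway.not_decomp_le_kerSubgroup_of_isCyclotomic`). THIS FILE proves the
abstract group-theoretic core, for a compact topological group `G`, a normal subgroup `I`, an
element `F` such that `F` and `I` generate every finite discrete quotient of `G` (the tree's
`exists_eq_frobenius_pow_mul_inertia_mul` for `G = Γ_{K_v}`), a continuous
`χ : G →ₜ* ℤ_p` (multiplicatively) with `χ(I) = 1`, `χ(F) ≠ 1`, and a finite discrete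
representation `X : TopRep ℤ G` killed by `p^e` (so BOTH the tree's `discreteTopRep G M` of
`SubgroupSelmer` and `ρ.toTopRep` of a `DiscreteGaloisModule` are covered):

  **every continuous `1`-cocycle `φ : G → X` which is a coboundary on `I` is a coboundary on
  `ker χ`** (`exists_eq_rho_sub_of_apply_eq_one`), hence its class dies under every map
  `H¹(G, X) → H¹(H, Y)` along a pair `(θ : H → G, f)` with `χ ∘ θ = 1`
  (`map_oneCocycleClass_eq_zero_of_apply_comp_eq_one`).

Compared with the X2 lineage's `X2.GreenbergVatsalProPrimeToPCocycle.exists_eq_smul_sub_of_vanishing_on_inertia`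
(Greenberg–Vatsal p. 17, same mechanism; pointer by seat p12 GEN 4): that theorem assumes the
inertia group acts TRIVIALLY on the module (good reduction) and starts from a cocycle on the
subgroup; here `I` may act non-trivially (bad, e.g. additive, places `v ≠ p`) — after subtracting
the `I`-coboundary the cocycle takes values in `X^I` — and the statement is for a cocycle on all
of `G`, unramified as a CLASS.

Proof ("`G'/I` is pro-prime-to-`p`", made finite): (1) subtract the `I`-coboundary, so `φ|_I = 0`;
then `φ` is constant on `I`-cosets with values in `X^I`; (2) `U₁ = {u : u` acts trivially on `X`,
`φ u = 0}` is an OPEN subgroup, `φ` is `U₁`-bi-invariant, and `F^N ∈ U₁` for some `N ≥ 1`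
(compactness: `G/U₁` finite); write `N = p^s N'`, `p ∤ N'`; (3) by continuity of `χ` there is an
open `U ≤ U₁` on which `p^{v(χ F)+s+1} ∣ χ`; writing `g ∈ ker χ` as `g = Fⁿ τ u` (`τ ∈ I`, `u ∈ U`)
forces `p^s ∣ n`, so `φ g = φ(F₁^{n/p^s})` with `F₁ = F^{p^s}`, `F₁^{N'} ∈ U₁`; (4) CYCLIC
AVERAGING over the `p'`-period `N'`: `b = −N'⁻¹ ∑_{k<N'} φ(F₁^k)` (`N'⁻¹ (mod p^e)`) has
`F₁^k b − b = φ(F₁^k)` for all `k`, and `b` is fixed by `I` and `U₁`; so `φ g = g b − b` on `ker χ`.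

References: J.-P. Serre, *Galois Cohomology* I.§2, I.§5.1 (cocycles; `H¹` of a finite group of
order prime to the module is `0`) [SerreGaloisCohomology1997]; J. Neukirch, *ANT* II (9.9)–(9.11)
(`Γ_{K_v}/I_v ≅ Ẑ` topologically generated by Frobenius) [NeukirchANT1999]; R. Greenberg,
V. Vatsal, Invent. Math. 142 (2000) p. 17 [GreenbergVatsal2000]; L. Washington, *Cyclotomic Fields*
Prop. 13.2 (`ℤ_p`-extensions unramified outside `p`) [Washington1997].
-/

set_option autoImplicit false

noncomputable section

open scoped Classical

open Literature.NumberTheory.GaloisRepresentations CategoryTheory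

namespace Summit.BirchSwinnertonDyer.Rank1Residual.Iwasawa

universe u

variable {G : Type u} [Group G] [TopologicalSpace G] [IsTopologicalGroup G] (X : TopRep.{u} ℤ G)

/-! ### §1 Cocycle algebra along powers of one element; cyclic averaging -/

section Cyclic

omit [IsTopologicalGroup G] in
/-- The cocycle identity along powers: `φ(h^k) = ∑_{j<k} h^j • φ(h)`. [folklore] -/
theorem cocycle_apply_pow_eq_sum (φ : contOneCocycles X) (h : G) (k : ℕ) :
    φ.1 (h ^ k) = ∑ j ∈ Finset.range k, X.ρ (h ^ j) (φ.1 h) := by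
  induction k with
  | zero => rw [pow_zero, contOneCocycles.apply_one, Finset.sum_range_zero]
  | succ k ih => rw [pow_succ, φ.2 (h ^ k) h, ih, Finset.sum_range_succ]

omit [TopologicalSpace G] [IsTopologicalGroup G] in
/-- `h^k • b − b = ∑_{j<k} h^j • (h • b − b)` (the coboundary of `b` along powers). [folklore] -/
theorem rho_pow_sub_eq_sum (h : G) (b : X) (k : ℕ) :
    X.ρ (h ^ k) b - b = ∑ j ∈ Finset.range k, X.ρ (h ^ j) (X.ρ h b - b) := by
  induction k with
  | zero => rw [pow_zero, map_one, Finset.sum_range_zero]; exact sub_self b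
  | succ k ih =>
    rw [Finset.sum_range_succ, ← ih, pow_succ, map_mul]
    change X.ρ (h ^ k) (X.ρ h b) - b = _
    rw [map_sub]
    abel

omit [IsTopologicalGroup G] in
/-- **Cyclic averaging over a period prime to `p`.** If `X` is killed by `p^e`, `p ∤ N'` and the
cocycle `φ` vanishes at `h^{N'}`, then `b = −N'⁻¹ ∑_{k<N'} φ(h^k)` (inverse mod `p^e`) satisfies
`φ(h^k) = h^k • b − b` for every `k`, and `b` is fixed by every operator fixing all the `φ(h^k)`
(the standard proof that `H¹` of a cyclic group of order prime to the exponent of the module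
vanishes, Serre *Galois Cohomology* I.§2). [cite: SerreGaloisCohomology1997, I.§2.2–2.4] -/
theorem exists_apply_pow_eq_rho_sub {p e N' : ℕ} (hN' : N'.Coprime p)
    (hM : ∀ m : X, p ^ e • m = 0) (φ : contOneCocycles X) (h : G) (hφN : φ.1 (h ^ N') = 0) :
    ∃ b : X, (∀ k : ℕ, φ.1 (h ^ k) = X.ρ (h ^ k) b - b) ∧
      ∀ T : X →+ X, (∀ k : ℕ, T (φ.1 (h ^ k)) = φ.1 (h ^ k)) → T b = b := by
  -- Bézout: `x * N' + y * p^e = 1`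
  have hcop : IsCoprime (N' : ℤ) ((p ^ e : ℕ) : ℤ) :=
    Nat.isCoprime_iff_coprime.mpr (Nat.Coprime.pow_right e hN')
  obtain ⟨x, y, hxy⟩ := hcop
  set S : X := ∑ k ∈ Finset.range N', φ.1 (h ^ k) with hS
  -- `h • S - S = -(N' • φ h)`
  have hstep : ∀ k : ℕ, X.ρ h (φ.1 (h ^ k)) = φ.1 (h ^ (k + 1)) - φ.1 h := fun k ↦ by
    rw [pow_succ', φ.2 h (h ^ k)]
    abel
  have hshift : ∑ k ∈ Finset.range N', φ.1 (h ^ (k + 1)) = S := by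
    have e1 := Finset.sum_range_succ' (fun k ↦ φ.1 (h ^ k)) N'
    have e2 := Finset.sum_range_succ (fun k ↦ φ.1 (h ^ k)) N'
    rw [pow_zero, contOneCocycles.apply_one, add_zero] at e1
    rw [hφN, add_zero] at e2
    rw [hS, ← e2, e1]
  have hSS : X.ρ h S - S = -((N' : ℤ) • φ.1 h) := by
    rw [hS, map_sum, Finset.sum_congr rfl fun k _ ↦ hstep k, Finset.sum_sub_distrib,
      hshift, Finset.sum_const, Finset.card_range, natCast_zsmul]
    abel
  refine ⟨-(x • S), fun k ↦ ?_, fun T hT ↦ ?_⟩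
  · -- `h • b - b = φ h`, then sum along powers
    have hb : X.ρ h (-(x • S)) - -(x • S) = φ.1 h := by
      rw [map_neg, map_zsmul, neg_sub_neg, ← smul_sub, ← neg_sub, smul_neg, hSS, smul_neg,
        neg_neg, smul_smul]
      have hpe : ((p ^ e : ℕ) : ℤ) • φ.1 h = 0 := by rw [natCast_zsmul]; exact hM _
      calc (x * N' : ℤ) • φ.1 h = (1 - y * (p ^ e : ℕ)) • φ.1 h := by rw [← hxy]; ring_nf
        _ = φ.1 h := by rw [sub_smul, one_smul, mul_smul, hpe, smul_zero, sub_zero]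
    rw [cocycle_apply_pow_eq_sum, rho_pow_sub_eq_sum, hb]
  · rw [map_neg, map_zsmul, hS, map_sum, Finset.sum_congr rfl fun k _ ↦ hT k]

end Cyclic

/-! ### §2 A cocycle vanishing on a normal subgroup `I` is `I`-bi-invariant with `I`-fixed values -/

section Inertia

omit [IsTopologicalGroup G] in
/-- If `φ|_I = 0` then `φ(g τ) = φ g` for `τ ∈ I`. [folklore] -/
theorem cocycle_apply_mul_eq_of_apply_eq_zero (φ : contOneCocycles X) {I : Subgroup G}
    (hφI : ∀ τ ∈ I, φ.1 τ = 0) (g : G) {τ : G} (hτ : τ ∈ I) : φ.1 (g * τ) = φ.1 g := by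
  rw [φ.2 g τ, hφI τ hτ, map_zero, add_zero]

omit [IsTopologicalGroup G] in
/-- If `φ|_I = 0` and `I` is normal then `τ • φ g = φ g` and `φ(τ g) = φ g` for `τ ∈ I` (values in
`X^I`). [folklore] -/
theorem rho_cocycle_apply_eq_of_apply_eq_zero (φ : contOneCocycles X) {I : Subgroup G}
    [hI : I.Normal] (hφI : ∀ τ ∈ I, φ.1 τ = 0) (g : G) {τ : G} (hτ : τ ∈ I) :
    X.ρ τ (φ.1 g) = φ.1 g ∧ φ.1 (τ * g) = φ.1 g := by
  have h1 : φ.1 (τ * g) = X.ρ τ (φ.1 g) := by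
    rw [φ.2 τ g, hφI τ hτ, zero_add]
  have h2 : φ.1 (τ * g) = φ.1 g := by
    have hconj : g⁻¹ * τ * g ∈ I := by
      simpa only [inv_inv] using hI.conj_mem τ hτ g⁻¹
    have : τ * g = g * (g⁻¹ * τ * g) := by group
    rw [this, cocycle_apply_mul_eq_of_apply_eq_zero X φ hφI g hconj]
  exact ⟨h1 ▸ h2, h2⟩

end Inertia

/-! ### §3 The main lemma -/

section Main

variable [CompactSpace G]

/-- **Unramified cocycles are coboundaries on `ker χ`.** Let `G` be a compact topological group,
`I ⊴ G` a normal subgroup, `F ∈ G` such that for every open subgroup `U` every `σ ∈ G` is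
`Fⁿ · τ · u` with `τ ∈ I`, `u ∈ U` (Frobenius and inertia generate every finite discrete quotient),
`χ : G →ₜ* ℤ_p` (written multiplicatively) a continuous homomorphism with `χ(I) = 1` and `χ F ≠ 1`,
`X` a finite discrete topological `ℤ`-representation of `G` with continuous orbit maps, killed by
`p^e`. Then every continuous `1`-cocycle `φ : G → X` whose restriction to `I` is a coboundary is a
coboundary on `ker χ`: `∃ b, φ g = g • b − b` for all `g` with `χ g = 1`. (Module docstring,
steps (1)–(4).)
[cite: SerreGaloisCohomology1997, I.§2.2–2.4 and I.§5.1] [cite: NeukirchANT1999, Ch. II §9 Prop. (9.9)–(9.11)] -/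
theorem exists_eq_rho_sub_of_apply_eq_one {p : ℕ} [hp : Fact p.Prime] {e : ℕ}
    [DiscreteTopology X] [Finite X]
    (hM : ∀ m : X, p ^ e • m = 0) (hcont : ∀ m : X, Continuous fun g : G ↦ X.ρ g m)
    (I : Subgroup G) [I.Normal] (F : G)
    (hgen : ∀ U : Subgroup G, IsOpen (U : Set G) → ∀ σ : G,
      ∃ (n : ℕ) (τ u : G), τ ∈ I ∧ u ∈ U ∧ σ = F ^ n * τ * u)
    (χ : G →ₜ* Multiplicative ℤ_[p]) (hχI : ∀ τ ∈ I, χ τ = 1) (hχF : χ F ≠ 1)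
    (φ : contOneCocycles X) (hφI : ∃ m : X, ∀ τ ∈ I, φ.1 τ = X.ρ τ m - m) :
    ∃ b : X, ∀ g : G, χ g = 1 → φ.1 g = X.ρ g b - b := by
  -- (1) subtract the `I`-coboundary
  obtain ⟨m, hm⟩ := hφI
  let cob : contOneCocycles X :=
    ⟨⟨fun g ↦ X.ρ g m - m, (hcont m).sub continuous_const⟩, fun g h ↦ by
      change X.ρ (g * h) m - m = (X.ρ g m - m) + X.ρ g (X.ρ h m - m)
      rw [map_mul]
      change X.ρ g (X.ρ h m) - m = _
      rw [map_sub]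
      abel⟩
  set ψ : contOneCocycles X := φ - cob with hψ_def
  have hψapply : ∀ g : G, ψ.1 g = φ.1 g - (X.ρ g m - m) := fun g ↦ rfl
  have hψI : ∀ τ ∈ I, ψ.1 τ = 0 := fun τ hτ ↦ by rw [hψapply, hm τ hτ, sub_self]
  suffices h : ∃ b : X, ∀ g : G, χ g = 1 → ψ.1 g = X.ρ g b - b by
    obtain ⟨b, hb⟩ := h
    refine ⟨b + m, fun g hg ↦ ?_⟩
    have := hb g hg
    rw [hψapply, sub_eq_iff_eq_add] at this
    rw [this, map_add]
    abel
  -- (2) the open subgroup `U₁ = {u : u • x = x ∀ x, ψ u = 0}`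
  let U₁ : Subgroup G :=
    { carrier := {u | (∀ x : X, X.ρ u x = x) ∧ ψ.1 u = 0}
      mul_mem' := fun {a b} ha hb ↦ ⟨fun x ↦ by
          rw [map_mul]
          change X.ρ a (X.ρ b x) = x
          rw [hb.1, ha.1], by
        rw [ψ.2 a b, hb.2, ha.2, map_zero, add_zero]⟩
      one_mem' := ⟨fun x ↦ by rw [map_one]; rfl, contOneCocycles.apply_one ψ⟩
      inv_mem' := fun {a} ha ↦ ⟨fun x ↦ by
          conv_lhs => rw [← ha.1 x]
          change (X.ρ a⁻¹ * X.ρ a) x = x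
          rw [← map_mul, inv_mul_cancel, map_one]; rfl, by
        have h0 := ψ.2 a⁻¹ a
        rw [inv_mul_cancel, contOneCocycles.apply_one, ha.2, map_zero, add_zero] at h0
        exact h0.symm⟩ }
  have hU₁open : IsOpen (U₁ : Set G) := by
    have h1 : IsOpen {u : G | ∀ x : X, X.ρ u x = x} := by
      rw [Set.setOf_forall]
      exact isOpen_iInter_of_finite fun x ↦ (isOpen_discrete {x}).preimage (hcont x)
    have h2 : IsOpen {u : G | ψ.1 u = 0} := (isOpen_discrete {(0 : X)}).preimage ψ.1.continuous
    exact h1.inter h2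
  -- `ψ` is `U₁`-bi-invariant and `I`-bi-invariant
  have hψ_mul_U : ∀ (g : G) {u : G}, u ∈ U₁ → ψ.1 (g * u) = ψ.1 g := fun g u hu ↦ by
    rw [ψ.2 g u, hu.2, map_zero, add_zero]
  have hψ_mul_I : ∀ (g : G) {τ : G}, τ ∈ I → ψ.1 (g * τ) = ψ.1 g :=
    fun g τ hτ ↦ cocycle_apply_mul_eq_of_apply_eq_zero X ψ hψI g hτ
  have hψ_Ifix : ∀ (g : G) {τ : G}, τ ∈ I → X.ρ τ (ψ.1 g) = ψ.1 g :=
    fun g τ hτ ↦ (rho_cocycle_apply_eq_of_apply_eq_zero X ψ hψI g hτ).1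
  -- a power of `F` lies in `U₁` (compactness: `G ⧸ U₁` is finite)
  haveI : DiscreteTopology (G ⧸ U₁) := QuotientGroup.discreteTopology hU₁open
  haveI : Finite (G ⧸ U₁) := finite_of_compact_of_discrete
  obtain ⟨N, hNpos, hFN⟩ : ∃ N : ℕ, 0 < N ∧ F ^ N ∈ U₁ := by
    obtain ⟨k, l, hkl, hq⟩ := Finite.exists_ne_map_eq_of_infinite
      (fun k : ℕ ↦ (QuotientGroup.mk (F ^ k) : G ⧸ U₁))
    have key : ∀ k l : ℕ, k < l → (QuotientGroup.mk (F ^ k) : G ⧸ U₁) = QuotientGroup.mk (F ^ l) →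
        ∃ N : ℕ, 0 < N ∧ F ^ N ∈ U₁ := fun k l h hq ↦ by
      refine ⟨l - k, Nat.sub_pos_of_lt h, ?_⟩
      have hmem := QuotientGroup.eq.mp hq
      have hpow : (F ^ k)⁻¹ * F ^ l = F ^ (l - k) := by
        rw [inv_mul_eq_iff_eq_mul, ← pow_add, Nat.add_sub_cancel' h.le]
      rwa [hpow] at hmem
    rcases Nat.lt_or_gt_of_ne hkl with h | h
    · exact key k l h hq
    · exact key l k h hq.symm
  -- `N = p^s · N'` with `p ∤ N'`; `F₁ = F^{p^s}` has `F₁^{N'} ∈ U₁`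
  set s : ℕ := N.factorization p with hs_def
  set N' : ℕ := N / p ^ s with hN'_def
  have hN : p ^ s * N' = N := Nat.ordProj_mul_ordCompl_eq_self N p
  have hN'cop : N'.Coprime p := (Nat.coprime_ordCompl hp.out hNpos.ne').symm
  have hF₁N' : (F ^ p ^ s) ^ N' = F ^ N := by rw [← pow_mul, hN]
  have hψF₁N' : ψ.1 ((F ^ p ^ s) ^ N') = 0 := by rw [hF₁N']; exact hFN.2
  obtain ⟨b, hb, hbfix⟩ := exists_apply_pow_eq_rho_sub X hN'cop hM ψ (F ^ p ^ s) hψF₁N'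
  -- (3) the open subgroup `V = {g : p^t ∣ χ g}`, `t = v(χ F) + s + 1`
  set c : ℤ_[p] := Multiplicative.toAdd (χ F) with hc_def
  have hc : c ≠ 0 := fun h ↦ hχF (by
    rw [← ofAdd_toAdd (χ F), ← hc_def, h, ofAdd_zero])
  set t : ℕ := c.valuation + s + 1 with ht_def
  let V : Subgroup G :=
    { carrier := {g | (p : ℤ_[p]) ^ t ∣ Multiplicative.toAdd (χ g)}
      mul_mem' := fun {a b} ha hb ↦ by
        simp only [Set.mem_setOf_eq, map_mul, toAdd_mul] at ha hb ⊢
        exact dvd_add ha hb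
      one_mem' := by simp only [Set.mem_setOf_eq, map_one, toAdd_one, dvd_zero]
      inv_mem' := fun {a} ha ↦ by
        simp only [Set.mem_setOf_eq, map_inv, toAdd_inv] at ha ⊢
        exact (dvd_neg).mpr ha }
  have hVopen : IsOpen (V : Set G) := by
    have hset : (V : Set G) = (fun g : G ↦ Multiplicative.toAdd (χ g)) ⁻¹'
        Metric.closedBall (0 : ℤ_[p]) ((p : ℝ) ^ (-(t : ℤ))) := by
      ext g
      simp only [SetLike.mem_coe, Set.mem_preimage, Metric.mem_closedBall, dist_zero_right]
      change (p : ℤ_[p]) ^ t ∣ Multiplicative.toAdd (χ g) ↔ _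
      rw [PadicInt.norm_le_pow_iff_mem_span_pow, Ideal.mem_span_singleton]
    rw [hset]
    refine (IsUltrametricDist.isOpen_closedBall (0 : ℤ_[p]) ?_).preimage
      (continuous_toAdd.comp (map_continuous χ))
    exact zpow_ne_zero _ (by exact_mod_cast hp.out.ne_zero)
  -- (4) every `g ∈ ker χ` is `F^{p^s k} · τ · u` with `τ ∈ I`, `u ∈ U₁ ⊓ V`
  refine ⟨b, fun g hg ↦ ?_⟩
  obtain ⟨n, τ, u, hτ, hu, rfl⟩ := hgen (U₁ ⊓ V) (hU₁open.inter hVopen) g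
  have hu₁ : u ∈ U₁ := (Subgroup.mem_inf.mp hu).1
  have huV : (p : ℤ_[p]) ^ t ∣ Multiplicative.toAdd (χ u) := (Subgroup.mem_inf.mp hu).2
  -- `p^s ∣ n` from `χ g = 1`
  have hdiv : p ^ s ∣ n := by
    have h1 : (n : ℤ_[p]) * c + Multiplicative.toAdd (χ u) = 0 := by
      have hg' : χ F ^ n * χ u = 1 := by
        rw [map_mul, map_mul, map_pow, hχI τ hτ, mul_one] at hg; exact hg
      have := congrArg Multiplicative.toAdd hg'
      rw [toAdd_mul, toAdd_pow, toAdd_one, ← hc_def, nsmul_eq_mul] at this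
      exact this
    have h2 : (p : ℤ_[p]) ^ t ∣ (n : ℤ_[p]) * c := by
      have : (n : ℤ_[p]) * c = -Multiplicative.toAdd (χ u) := eq_neg_of_add_eq_zero_left h1
      rw [this]; exact (dvd_neg).mpr huV
    rw [PadicInt.unitCoeff_spec hc, ht_def, show c.valuation + s + 1 = (s + 1) + c.valuation by ring,
      pow_add, ← mul_assoc] at h2
    have h3 : (p : ℤ_[p]) ^ (s + 1) ∣ (n : ℤ_[p]) * (PadicInt.unitCoeff hc : ℤ_[p]) :=
      (mul_dvd_mul_iff_right (pow_ne_zero _ (Nat.cast_ne_zero.mpr hp.out.ne_zero))).mp h2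
    have h4 : (p : ℤ_[p]) ^ (s + 1) ∣ (n : ℤ_[p]) := (Units.dvd_mul_right).mp h3
    have h5 : (p ^ (s + 1) : ℤ) ∣ (n : ℤ) := by
      rw [← PadicInt.pow_p_dvd_int_iff]; exact_mod_cast h4
    have h6 : p ^ (s + 1) ∣ n := by exact_mod_cast h5
    exact (pow_dvd_pow p (Nat.le_succ s)).trans h6
  obtain ⟨k, rfl⟩ := hdiv
  -- `ψ g = ψ(F₁^k) = F₁^k • b - b = g • b - b`
  have e1 : ψ.1 (F ^ (p ^ s * k) * τ * u) = ψ.1 ((F ^ p ^ s) ^ k) := by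
    rw [hψ_mul_U _ hu₁, hψ_mul_I _ hτ, pow_mul]
  have hτb : X.ρ τ b = b := hbfix (X.ρ τ : X →+ X) fun j ↦ hψ_Ifix _ hτ
  have hub : X.ρ u b = b := hu₁.1 b
  rw [e1, hb k, map_mul, map_mul]
  change _ = X.ρ (F ^ (p ^ s * k)) (X.ρ τ (X.ρ u b)) - b
  rw [hub, hτb, pow_mul]

variable {H : Type u} [Group H] [TopologicalSpace H] [IsTopologicalGroup H] {Y : TopRep.{u} ℤ H}

/-- **`res_{ker χ} [φ] = 0`, functorially** — the `H¹` form of `exists_eq_rho_sub_of_apply_eq_one`: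
under its hypotheses, the class `[φ] ∈ H¹(G, X)` dies under the map `H¹(G, X) → H¹(H, Y)` induced
by any compatible pair `(θ : H → G, f : res_θ X ⟶ Y)` whose group component lands in `ker χ`
(`χ (θ h) = 1` for all `h`): `[f ∘ φ ∘ θ] = ∂(f b)`. For `θ` the inclusion of
`ker χ = Gal(K̄_v/K_{∞,η})` and `f` the change of coefficients `E[p] → E(K̄_v)` this is the local
condition of `Sel_{p^∞}(E/K_∞)` at `η`. [cite: SerreGaloisCohomology1997, I.§2.4 and I.§5.1] -/
theorem map_oneCocycleClass_eq_zero_of_apply_comp_eq_one {p : ℕ} [hp : Fact p.Prime] {e : ℕ}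
    [DiscreteTopology X] [Finite X]
    (hM : ∀ m : X, p ^ e • m = 0) (hcont : ∀ m : X, Continuous fun g : G ↦ X.ρ g m)
    (I : Subgroup G) [I.Normal] (F : G)
    (hgen : ∀ U : Subgroup G, IsOpen (U : Set G) → ∀ σ : G,
      ∃ (n : ℕ) (τ u : G), τ ∈ I ∧ u ∈ U ∧ σ = F ^ n * τ * u)
    (χ : G →ₜ* Multiplicative ℤ_[p]) (hχI : ∀ τ ∈ I, χ τ = 1) (hχF : χ F ≠ 1)
    (φ : contOneCocycles X) (hφI : ∃ m : X, ∀ τ ∈ I, φ.1 τ = X.ρ τ m - m)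
    (θ : H →ₜ* G) (f : TopRep.res (θ : H →* G) X ⟶ Y) (hθ : ∀ h : H, χ (θ h) = 1) :
    ContinuousCohomology.map θ f 1 (oneCocycleClass X φ) = 0 := by
  obtain ⟨b, hb⟩ := exists_eq_rho_sub_of_apply_eq_one X hM hcont I F hgen χ hχI hχF φ hφI
  rw [map_oneCocycleClass, oneCocycleClass_eq_zero_iff]
  refine ⟨f.hom b, fun h ↦ ?_⟩
  rw [contOneCocycles.pullback_apply, hb (θ h) (hθ h), map_sub]
  congr 1
  exact TopRep.hom_comm_apply f h b

end Main

end Summit.BirchSwinnertonDyer.Rank1Residual.Iwasawa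

end
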